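import Summits.MatrixMultiplication.MatrixMultiplication.Theses.SaturationLadder
import Summits.MatrixMultiplication.MatrixMultiplication.Theorems.SaturationLadderExpSaturation
import HarnessLib

/-!
# SaturationLadder — the twin rung reduces to a SEQUENCE of exact certificates

Route `SaturationLadder` (sub-problem `MatrixMultiplication`), aside `TwinSaturation`
(stmt-MatrixMultiplication-30539): `∃ C, ∀ t ∈ [0,1), ∃ r ∈ [1, C · 3^{1/(1−t)}], ω(1, t, r) ≤ 1 + r`.

`twinSaturation_of_certificates`: it suffices to have a sequence of saturation points `(t_k, r_k)`,
`1 ≤ r_k`, `ω(1, t_k, r_k) ≤ 1 + r_k`, whose abscissae exhaust `[0,1)` (every `t < 1` is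
`≤ t_k` for some `k`) and whose ordinates grow at most like the twin base along the sequence:
`r_0 ≤ 3 C` and `r_{k+1} ≤ C · 3^{1/(1−t_k)}`.  (For `t ∈ (t_{k−1}, t_k]` take `r = r_k`:
monotonicity of `ω(1, ·, r)` — `omegaRect_mono'` — and of `3^{1/(1−·)}`.)

The intended sequence is the family of exact twin certificates `omegaRect_one_tw_exact`
(`Theorems/SaturationLadderTwinExact.lean`; certified instances `j = 5, 8` in
`Theorems/SaturationLadderTwinExactInstances.lean`), one per `j`, along which
`(1 − t_j) log r_j → (5 log 5 − 7 log 2)/3 < log 3` while `(1 − t_{j+1})/(1 − t_j) → 1`, so that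
`r_{j+1} · 3^{−1/(1−t_j)} → 0` (cell `decomp-mm`, lens 1, gen 8: what is left for the rung is the pair of
entropy inequalities `H(Z) ≤ H(X), H(Y)` along a parametric family of output-perfect types, for all
large `j`).  No definitions, no named facts, no sorry.
-/

set_option linter.dupNamespace false
-- (single-conjunct summit: the namespace repeats `MatrixMultiplication`)

noncomputable section

namespace Summit.MatrixMultiplication.MatrixMultiplication.Theorems.SaturationLadderTwinReduction

open Literature.Computability.AlgebraicComplexity
open Summit.MatrixMultiplication.MatrixMultiplication.Theses.SaturationLadder (TwinSaturation)
open Summit.MatrixMultiplication.MatrixMultiplication.Theorems.SaturationLadderExpSaturation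
  (omegaRect_mono')

/-- `3^{1/(1−·)}` is monotone on `[0,1)`: `s ≤ t < 1 ⇒ 3^{1/(1−s)} ≤ 3^{1/(1−t)}`. [folklore] -/
theorem three_rpow_inv_mono {s t : ℝ} (hst : s ≤ t) (ht : t < 1) :
    (3 : ℝ) ^ (1 / (1 - s)) ≤ (3 : ℝ) ^ (1 / (1 - t)) := by
  apply Real.rpow_le_rpow_of_exponent_le (by norm_num)
  exact one_div_le_one_div_of_le (by linarith) (by linarith)

/-- `3 ≤ 3^{1/(1−t)}` for `t ∈ [0,1)`. [folklore] -/
theorem three_le_three_rpow_inv {t : ℝ} (ht0 : 0 ≤ t) (ht : t < 1) :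
    (3 : ℝ) ≤ (3 : ℝ) ^ (1 / (1 - t)) := by
  have h := three_rpow_inv_mono ht0 ht
  simpa using h

/-- **The twin rung from a sequence of exact certificates.**  If `(t_k, r_k)_{k ∈ ℕ}` satisfy
`1 ≤ r_k`, `ω(1, t_k, r_k) ≤ 1 + r_k`, every `t < 1` is `≤ t_k` for some `k`, `r_0 ≤ 3 C` and
`r_{k+1} ≤ C · 3^{1/(1−t_k)}`, then `TwinSaturation` (with the constant `C`).
[cite: AlmanDuanVassilevskaWilliamsXuXuZhou2025, §3.4] -/
theorem twinSaturation_of_certificates (C : ℝ) (t r : ℕ → ℝ) (hr1 : ∀ k, 1 ≤ r k) (hsat : ∀ k, omegaRect ℂ 1 (t k) (r k) ≤ 1 + r k)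
    (hcov : ∀ s : ℝ, s < 1 → ∃ k, s ≤ t k) (h0 : r 0 ≤ 3 * C)
    (hstep : ∀ k, r (k + 1) ≤ C * (3 : ℝ) ^ (1 / (1 - t k))) : TwinSaturation := by
  refine ⟨C, fun s hs0 hs1 => ?_⟩
  classical
  have hex : ∃ k, s ≤ t k := hcov s hs1
  -- the least index `k` with `s ≤ t_k`
  refine ⟨r (Nat.find hex), hr1 _, ?_, ?_⟩
  · -- growth: `r_k ≤ C · 3^{1/(1−s)}`
    rcases Nat.eq_zero_or_pos (Nat.find hex) with hk0 | hkpos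
    · rw [hk0]
      have hC : 0 ≤ C := by linarith [hr1 0]
      exact h0.trans (by nlinarith [three_le_three_rpow_inv hs0 hs1])
    · obtain ⟨k, hk⟩ : ∃ k, Nat.find hex = k + 1 := ⟨Nat.find hex - 1, by omega⟩
      rw [hk]
      -- minimality: `t_k < s`
      have hlt : t k < s := by
        have := Nat.find_min hex (show k < Nat.find hex by omega)
        exact lt_of_not_ge this
      have hC : 0 ≤ C := by linarith [hr1 0]
      exact (hstep k).trans (mul_le_mul_of_nonneg_left (three_rpow_inv_mono hlt.le hs1) hC)
  · -- saturation: `ω(1, s, r_k) ≤ ω(1, t_k, r_k) ≤ 1 + r_k`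
    have hsk : s ≤ t (Nat.find hex) := Nat.find_spec hex
    exact (omegaRect_mono' le_rfl hsk le_rfl).trans (hsat _)

end Summit.MatrixMultiplication.MatrixMultiplication.Theorems.SaturationLadderTwinReduction

end
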